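import Summits.BirchSwinnertonDyer.BirchSwinnertonDyer.Theorems.CyclotomicUntwistK2OfCruxesOfPrint
import Summits.BirchSwinnertonDyer.BirchSwinnertonDyer.Theorems.CyclotomicUntwistC1OfPrintFive
import HarnessLib

/-!
# Crux K2 `PSRankOneUpperHalfAtThree` ⟸ its two RESEARCH children + FIVE named print facts, by name — a CONDITIONAL result
# (Carayol's level theorem dropped from the lead's six)

Cell `pub/bsd-wall` (D-0145 line `route-BirchSwinnertonDyer-CyclotomicUntwist` rev 9), seat `bsd-line-cycu-p3` (prover seat 3/3,
gen 11). THEOREMS ONLY (no definition, no new named fact, no `sorry`). BSD is not proved by this file and the crux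
`PSRankOneUpperHalfAtThree` (stmt-BirchSwinnertonDyer-21581) is NOT closed by it: the theorem is CONDITIONAL on the two RESEARCH children
of the K-SEP split — `PSGrossZagierDescendedEigenlineAtThree` (C4, stmt-BirchSwinnertonDyer-27546) and `PSpAdicBSDKatoSideDescendedEigenlineAtThree` (C5≤,
stmt-BirchSwinnertonDyer-27592), both OPEN research statements (3-adic Gross–Zagier / one-sided 3-adic BSD at slope ½ with
nebentypus at 3, not in print) — and on FIVE named print facts: modularity (`nonempty_modularParametrizationData`),
Gross–Zagier I.(7.3) (`GrossZagier1986_thm_I_7_3`), Gross–Zagier–Kolyvagin (`PublishedInputGZK`, route item 19921), Deligne's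
`ℓ`-adic representations of `Γ₁`-newforms (`Hida2000_thm326_exists_galoisRep`) and Carayol 1986 Thm. (A) in Euler-factor form
(`Carayol1986_eulerFactor`). It is the lead's `PSRankOneHalvesOfCruxes.psRankOneUpperHalfAtThree_of_cruxes_of_print` (cycu-p1 g8,
six facts) with the Carayol-LEVEL binder `hlev : ∀ N, IsNewformOf.level_eq_conductorNorm (N := N)` supplied by the tree
(`PSC1OfPrintFive.level_eq_conductorNorm_of_modularity`: a newform of `W` at level `N_W` exists by modularity, and
Atkin–Lehner's strong multiplicity one across levels pins every other newform of `W`). The print packet under K2 is therefore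
{`nonempty_modularParametrizationData`, `GrossZagier1986_thm_I_7_3`, `Hida2000_thm326_exists_galoisRep`, `Carayol1986_eulerFactor`}
∪ {`PublishedInputGZK`}; the research wall is unchanged.

References: [cite: MazurTateTeitelbaum1986Invent, §I.14] · [cite: CarayolASENS1986, Thm. (A)] · [cite: GrossZagier1986, Thm. I.(7.3)]
· [cite: AtkinLehner1970, Thm. 4] · [cite: Kobayashi2013, Cor. 1.3].
-/

noncomputable section

open Literature.NumberTheory.EllipticCurves Literature.NumberTheory.EllipticCurves.ModularForms
  Summit.BirchSwinnertonDyer.BirchSwinnertonDyer.Theses.CyclotomicUntwist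

-- single-conjunct summit: `Summit.BirchSwinnertonDyer.BirchSwinnertonDyer.…` repeats the name by design
set_option linter.dupNamespace false
set_option autoImplicit false

namespace Summit.BirchSwinnertonDyer.BirchSwinnertonDyer.Theorems.PSRankOneHalvesOfCruxesFive

/-- **`PSRankOneUpperHalfAtThree` ⟸ C4 + C5≤ + five named print facts (CONDITIONAL; nothing here asserts C4 or C5≤).**
The lead's six-fact closer with `hlev := PSC1OfPrintFive.level_eq_conductorNorm_of_modularity hmod`.
[cite: MazurTateTeitelbaum1986Invent, §I.14] [cite: CarayolASENS1986, Thm. (A)] [cite: GrossZagier1986, Thm. I.(7.3)]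
[cite: AtkinLehner1970, Thm. 4] -/
theorem psRankOneUpperHalfAtThree_of_cruxes_of_print5
    (hC4 : PSGrossZagierDescendedEigenlineAtThree) (hC5 : PSpAdicBSDKatoSideDescendedEigenlineAtThree)
    (hmod : nonempty_modularParametrizationData)
    (hGZ86 : GrossZagier1986_thm_I_7_3) (hGZK : PublishedInputGZK)
    (hD : Hida2000_thm326_exists_galoisRep) (hCar : Carayol1986_eulerFactor) :
    PSRankOneUpperHalfAtThree :=
  PSRankOneHalvesOfCruxes.psRankOneUpperHalfAtThree_of_cruxes_of_print hC4 hC5 hmod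
    (PSC1OfPrintFive.level_eq_conductorNorm_of_modularity hmod) hGZ86 hGZK hD hCar

end Summit.BirchSwinnertonDyer.BirchSwinnertonDyer.Theorems.PSRankOneHalvesOfCruxesFive

end
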